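import Mathlib
import Summits.Ventures.HodgeRepro.Tier4.Target
import Summits.Ventures.HodgeRepro.Tier4.Line3.Defs
import Summits.Ventures.HodgeRepro.Tier4.Line3.DefsLemmas
import Summits.Ventures.HodgeRepro.Tier4.Line3.KMDatum
import Summits.Ventures.HodgeRepro.Tier4.Line3.KMDatumS
import Summits.Ventures.HodgeRepro.Tier4.Line3.HeckeEquivarianceLemmas
import Summits.Ventures.HodgeRepro.Tier4.Line3.UnitCopyScaling
import Summits.Ventures.HodgeRepro.Tier4.Line3.UnitCopyPos
import Summits.Ventures.HodgeRepro.Tier4.Line3.CopyWeightGaussian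
import Summits.Ventures.HodgeRepro.Tier4.Line3.CopyWeightBoundShrinkRed
import Summits.Ventures.HodgeRepro.Tier4.Line3.CopyCountRay

/-!
# Tier4/Line3/HKRayReduction — (HK′) along the integer ray reduces to an `n`-free two-parameter dilation comparison

Blind re-derivation cell `pub-hodge-repro`, Tier 4 «PROVE THE STEP», LINE L3, seat t4-x2 (g4, reserve wall-breaker),
cut C-L3-HKRAY (plan-3 g4, bus S14230 / S14274): plan-3's reduction (1)–(3) as a theorem.

At a symmetric centre `xm` (`xm 2 = xm 0`, `xm 3 = xm 1`) write `y_j := ballCoord (xm j)`, `h_j := tauSize (xm j)`,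
`m_j(z) := maj(y_j, z) − h_j` (`redMaj`, `≥ 0` on the ball) and `P(z) := Re kernel(xm, z) · e^{2π(maj_0 + maj_1)}`
(`gaussFree`, the Gaussian-free part of the kernel).  Along the ray `n • xm` every majorant and size scales by `n²`
and the kernel by `n⁸ e^{−2π(n²−1)(maj_0+maj_1)}`, so the (HK′) clause `MajorantMomentBoundRed D (rayCentre xm n) A k`
at the moment parameters `s ∈ [0,1)⁴` is exactly

  `∫_𝔹 P e^{−π n² [(2−s_0−s_2) m_0 + (2−s_1−s_3) m_1]} ≤ A ∏_j (1−s_j)^{−k} ∫_𝔹 P e^{−2π n² (m_0+m_1)}`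

(`moment_integrand_rayCentre`, `kernel_re_rayCentre_eq`).  Hence it FOLLOWS from the `n`-free DILATION COMPARISON
`DilationComparison D xm A k`: `I(λa, λb) ≤ A (2/a)^k (2/b)^k I(2λ, 2λ)` for `λ ≥ 1`, `a, b ∈ (0, 2]`, with
`I(α, β) := ∫_𝔹 P e^{−π(α m_0 + β m_1)}` (`dilInt`), because `(2/a)^k ≤ (1−s_0)^{−k} (1−s_2)^{−k}` for `a = 2−s_0−s_2`
(`two_div_rpow_le`).  `hkRed_ray_of_dilationComparison` is the cut `hkRed_ray` of S14230 with the comparison DISPLAYED.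

CAVEAT (bus S14325 (F5)): the comparison is FALSE for the interface `KMDatumS` alone (a continuous datum vanishing on a
neighbourhood of the `J`-orthogonal point `z*` of the centre and not elsewhere has ratio `≥ c e^{+π n² μ}` at
`s = (½,½,½,½)`); it can hold only through `ThetaData.equiv` (+ `nondeg`), under which the datum is a scalar multiple
of the Kudla–Millson datum and `P` vanishes on the two complex lines through `z*` (DatumOrthVanishing) — the interior
Laplace exponent is `k = 2`.  Nothing of that analysis is typed here: this module is the bookkeeping of the ray only.

Nothing here says anything about the status of the Hodge conjecture for CM abelian varieties, which is NOT proved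
(HC_CM is NOT proved by anyone in this repository).
-/

set_option autoImplicit false

noncomputable section

namespace Summit.Ventures.HodgeRepro.Tier4.Line3

open Summit.Ventures.HodgeRepro.Tier4
open Matrix MeasureTheory
open scoped ComplexConjugate

/-! ## 1. The elementary inequality `(2/(u+v))^k ≤ (uv)^{-k}` on `(0,1]²` -/

/-- `(2/(2 − s₀ − s₂))^k ≤ (1−s₀)^{−k} (1−s₂)^{−k}` for `s₀, s₂ ∈ [0,1)`, `k ≥ 0`. -/
theorem two_div_rpow_le {s0 s2 k : ℝ} (h0 : 0 ≤ s0) (h0' : s0 < 1) (h2 : 0 ≤ s2) (h2' : s2 < 1) (hk : 0 ≤ k) :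
    (2 / (2 - s0 - s2)) ^ k ≤ (1 - s0) ^ (-k) * (1 - s2) ^ (-k) := by
  have hu : 0 < 1 - s0 := by linarith
  have hv : 0 < 1 - s2 := by linarith
  have huv : 0 < (1 - s0) * (1 - s2) := mul_pos hu hv
  have hab : 0 < 2 - s0 - s2 := by linarith
  rw [Real.rpow_neg hu.le, Real.rpow_neg hv.le, ← mul_inv, ← Real.mul_rpow hu.le hv.le, ← Real.inv_rpow huv.le]
  apply Real.rpow_le_rpow (by positivity) _ hk
  rw [inv_eq_one_div, div_le_iff₀ hab, one_div, inv_mul_eq_div, le_div_iff₀ huv]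
  nlinarith [mul_nonneg hu.le (by linarith : (0 : ℝ) ≤ 1 - (1 - s2)),
    mul_nonneg hv.le (by linarith : (0 : ℝ) ≤ 1 - (1 - s0))]

namespace T4Data

variable (X : T4Data)

/-! ## 2. The objects of the comparison -/

/-- The reduced majorant of slot `j` of the centre: `maj(y_j, z) − tauSize (xm j)`. -/
def redMaj (xm : X.Tuple) (j : Fin 4) (z : Fin 2 → ℂ) : ℝ :=
  maj (X.ballCoord (xm j)) z - X.tauSize (xm j)

/-- The Gaussian-free part of the kernel at the centre: `Re kernel(xm, z) · e^{2π(maj_0 + maj_1)}`. -/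
def gaussFree (D : X.ThetaData) (xm : X.Tuple) (z : Fin 2 → ℂ) : ℝ :=
  (X.kernel D.Φ xm z).re *
    Real.exp (2 * Real.pi * (maj (X.ballCoord (xm 0)) z + maj (X.ballCoord (xm 1)) z))

/-- The two-parameter integrand `P · e^{−π(α m_0 + β m_1)}`. -/
def dilInt (D : X.ThetaData) (xm : X.Tuple) (α β : ℝ) (z : Fin 2 → ℂ) : ℝ :=
  X.gaussFree D xm z * Real.exp (-(Real.pi * (α * X.redMaj xm 0 z + β * X.redMaj xm 1 z)))

/-- **THE DILATION COMPARISON** (DISPLAYED): `I(λa, λb) ≤ A (2/a)^k (2/b)^k I(2λ, 2λ)` for all `λ ≥ 1` and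
`a, b ∈ (0, 2]`, with the integrability of the left integrand — the `n`-free content of (HK′) along the ray.  FALSE for
the interface `KMDatumS` alone; its truth for a `ThetaData` rests on `equiv` (bus S14325 (F5)–(F8)). -/
def DilationComparison (D : X.ThetaData) (xm : X.Tuple) (A k : ℝ) : Prop :=
  ∀ lam : ℝ, 1 ≤ lam → ∀ a b : ℝ, 0 < a → a ≤ 2 → 0 < b → b ≤ 2 →
    IntegrableOn (X.dilInt D xm (lam * a) (lam * b)) ball ∧
    ∫ z in ball, X.dilInt D xm (lam * a) (lam * b) z ≤
      A * (2 / a) ^ k * (2 / b) ^ k * ∫ z in ball, X.dilInt D xm (2 * lam) (2 * lam) z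

/-- The kernel at a symmetric centre has non-negative real part. -/
theorem kernel_re_nonneg_symm (Φ : KMDatumS) (xm : X.Tuple) (h02 : xm 2 = xm 0) (h13 : xm 3 = xm 1)
    (z : Fin 2 → ℂ) : 0 ≤ (X.kernel Φ xm z).re := by
  rw [X.kernel_symm Φ xm h02 h13, Complex.ofReal_re]
  exact Complex.normSq_nonneg _

/-- The Gaussian-free part is non-negative at a symmetric centre. -/
theorem gaussFree_nonneg (D : X.ThetaData) (xm : X.Tuple) (h02 : xm 2 = xm 0) (h13 : xm 3 = xm 1)
    (z : Fin 2 → ℂ) : 0 ≤ X.gaussFree D xm z :=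
  mul_nonneg (X.kernel_re_nonneg_symm D.Φ xm h02 h13 z) (Real.exp_pos _).le

/-- The two-parameter integrand is non-negative at a symmetric centre. -/
theorem dilInt_nonneg (D : X.ThetaData) (xm : X.Tuple) (h02 : xm 2 = xm 0) (h13 : xm 3 = xm 1) (α β : ℝ)
    (z : Fin 2 → ℂ) : 0 ≤ X.dilInt D xm α β z :=
  mul_nonneg (X.gaussFree_nonneg D xm h02 h13 z) (Real.exp_pos _).le

/-- The real part of the kernel at the centre is `P · e^{−2π(maj_0+maj_1)}`. -/
theorem kernel_re_eq_gaussFree (D : X.ThetaData) (xm : X.Tuple) (z : Fin 2 → ℂ) :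
    (X.kernel D.Φ xm z).re = X.gaussFree D xm z *
      Real.exp (-(2 * Real.pi * (maj (X.ballCoord (xm 0)) z + maj (X.ballCoord (xm 1)) z))) := by
  unfold gaussFree
  rw [mul_assoc, ← Real.exp_add, add_neg_cancel, Real.exp_zero, mul_one]

/-! ## 3. The ray: every size scales by `n²`, the kernel by `n⁸ e^{−2π(n²−1)(maj_0+maj_1)}` -/

/-- Ball coordinates along the ray. -/
theorem ballCoord_rayCentre (xm : X.Tuple) (n : ℕ) (j : Fin 4) :
    X.ballCoord (X.rayCentre xm n j) = (n : ℂ) • X.ballCoord (xm j) := by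
  unfold rayCentre
  rw [X.ballCoord_smul, map_natCast]

/-- The majorant along the ray. -/
theorem maj_rayCentre (xm : X.Tuple) (n : ℕ) (j : Fin 4) (z : Fin 2 → ℂ) :
    maj (X.ballCoord (X.rayCentre xm n j)) z = (n : ℝ) ^ 2 * maj (X.ballCoord (xm j)) z := by
  rw [X.ballCoord_rayCentre, maj_smul_complex, Complex.norm_natCast]

/-- The reduced majorant along the ray. -/
theorem redMaj_rayCentre (xm : X.Tuple) (n : ℕ) (j : Fin 4) (z : Fin 2 → ℂ) :
    maj (X.ballCoord (X.rayCentre xm n j)) z - X.tauSize (X.rayCentre xm n j) = (n : ℝ) ^ 2 * X.redMaj xm j z := by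
  rw [X.maj_rayCentre, X.tauSize_rayCentre, redMaj]
  ring

/-- The ray centre is symmetric when the centre is. -/
theorem rayCentre_symm (xm : X.Tuple) (h02 : xm 2 = xm 0) (h13 : xm 3 = xm 1) (n : ℕ) :
    X.rayCentre xm n 2 = X.rayCentre xm n 0 ∧ X.rayCentre xm n 3 = X.rayCentre xm n 1 := by
  unfold rayCentre
  rw [h02, h13]
  exact ⟨rfl, rfl⟩

/-- The kernel along the ray: `kernel(n • xm, z) = n⁸ e^{−π(n²−1) Σ_j maj(y_j, z)} · kernel(xm, z)`. -/
theorem kernel_rayCentre (Φ : KMDatumS) (xm : X.Tuple) (n : ℕ) (z : Fin 2 → ℂ) :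
    X.kernel Φ (X.rayCentre xm n) z =
      (((n : ℝ) ^ 8 * Real.exp (-(Real.pi * (((n : ℝ) ^ 2 - 1) * ∑ j, maj (X.ballCoord (xm j)) z))) : ℝ) : ℂ) *
        X.kernel Φ xm z := by
  have h := X.kernel_smul_family Φ (fun _ => (n : X.E)) xm z
  have hscale : X.kernelScale (fun _ => (n : X.E)) xm z =
      (n : ℝ) ^ 8 * Real.exp (-(Real.pi * (((n : ℝ) ^ 2 - 1) * ∑ j, maj (X.ballCoord (xm j)) z))) := by
    unfold kernelScale
    simp only [map_natCast, Complex.norm_natCast]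
    rw [Finset.prod_mul_distrib, Finset.prod_const, Finset.card_univ, Fintype.card_fin, ← Real.exp_sum,
      Finset.mul_sum, Finset.mul_sum, ← Finset.sum_neg_distrib]
    congr 1
    ring
  rw [← hscale]
  exact h

/-- The real part of the kernel along a symmetric ray: `n⁸ e^{−2π n² (h_0+h_1)} · P · e^{−2π n² (m_0+m_1)}`. -/
theorem kernel_re_rayCentre_eq (D : X.ThetaData) (xm : X.Tuple) (h02 : xm 2 = xm 0) (h13 : xm 3 = xm 1) (n : ℕ)
    (z : Fin 2 → ℂ) :
    (X.kernel D.Φ (X.rayCentre xm n) z).re =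
      ((n : ℝ) ^ 8 * Real.exp (-(2 * Real.pi * (n : ℝ) ^ 2 * (X.tauSize (xm 0) + X.tauSize (xm 1))))) *
        X.dilInt D xm (2 * (n : ℝ) ^ 2) (2 * (n : ℝ) ^ 2) z := by
  rw [X.kernel_rayCentre, Complex.re_ofReal_mul, X.kernel_re_eq_gaussFree, Fin.sum_univ_four, h02, h13]
  unfold dilInt redMaj
  have key : ∀ a b c : ℝ, (n : ℝ) ^ 8 * Real.exp a * (X.gaussFree D xm z * Real.exp b) =
      (n : ℝ) ^ 8 * Real.exp c * (X.gaussFree D xm z * Real.exp (a + b - c)) := by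
    intro a b c
    rw [Real.exp_sub, Real.exp_add]
    have hc : Real.exp c ≠ 0 := (Real.exp_pos c).ne'
    field_simp
  rw [key _ _ (-(2 * Real.pi * (n : ℝ) ^ 2 * (X.tauSize (xm 0) + X.tauSize (xm 1))))]
  congr 3
  ring

/-- **THE MOMENT INTEGRAND ALONG THE RAY** is `n⁸ e^{−2π n²(h_0+h_1)}` times the two-parameter integrand at
`λ = n²`, `a = 2 − s_0 − s_2`, `b = 2 − s_1 − s_3`. -/
theorem moment_integrand_rayCentre (D : X.ThetaData) (xm : X.Tuple) (h02 : xm 2 = xm 0) (h13 : xm 3 = xm 1) (n : ℕ)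
    (s : Fin 4 → ℝ) (z : Fin 2 → ℂ) :
    Real.exp (Real.pi * ∑ j, s j * (maj (X.ballCoord (X.rayCentre xm n j)) z - X.tauSize (X.rayCentre xm n j))) *
        (X.kernel D.Φ (X.rayCentre xm n) z).re =
      ((n : ℝ) ^ 8 * Real.exp (-(2 * Real.pi * (n : ℝ) ^ 2 * (X.tauSize (xm 0) + X.tauSize (xm 1))))) *
        X.dilInt D xm ((n : ℝ) ^ 2 * (2 - s 0 - s 2)) ((n : ℝ) ^ 2 * (2 - s 1 - s 3)) z := by
  rw [X.kernel_re_rayCentre_eq D xm h02 h13, Fin.sum_univ_four, X.redMaj_rayCentre, X.redMaj_rayCentre,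
    X.redMaj_rayCentre, X.redMaj_rayCentre]
  have h2 : X.redMaj xm 2 z = X.redMaj xm 0 z := by simp only [redMaj, h02]
  have h3 : X.redMaj xm 3 z = X.redMaj xm 1 z := by simp only [redMaj, h13]
  rw [h2, h3]
  unfold dilInt
  have key : ∀ a b c : ℝ, Real.exp a * (c * (X.gaussFree D xm z * Real.exp b)) =
      c * (X.gaussFree D xm z * Real.exp (a + b)) := by
    intro a b c
    rw [Real.exp_add]
    ring
  rw [key]
  congr 3
  ring

/-! ## 4. The reduction -/

/-- **(HK′) ALONG THE RAY FROM THE DILATION COMPARISON** — plan-3's reduction (1)–(3) (bus S14230) as a theorem: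
at a symmetric centre, `DilationComparison D xm A k` (with `A, k ≥ 0`) gives `MajorantMomentBoundRed D (rayCentre xm n) A k`
for every `n ≥ 1`. -/
theorem hkRed_ray_of_dilationComparison (D : X.ThetaData) (xm : X.Tuple) (h02 : xm 2 = xm 0) (h13 : xm 3 = xm 1)
    {A k : ℝ} (hA : 0 ≤ A) (hk : 0 ≤ k) (hcomp : X.DilationComparison D xm A k) (n : ℕ) (hn : 1 ≤ n) :
    X.MajorantMomentBoundRed D (X.rayCentre xm n) A k := by
  intro s hs
  set lam : ℝ := (n : ℝ) ^ 2 with hlam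
  have hlam1 : 1 ≤ lam := by
    have : (1 : ℝ) ≤ n := by exact_mod_cast hn
    rw [hlam]; nlinarith
  set a : ℝ := 2 - s 0 - s 2 with ha
  set b : ℝ := 2 - s 1 - s 3 with hb
  have ha0 : 0 < a := by have := hs 0; have := hs 2; rw [ha]; linarith
  have ha2 : a ≤ 2 := by have := hs 0; have := hs 2; rw [ha]; linarith
  have hb0 : 0 < b := by have := hs 1; have := hs 3; rw [hb]; linarith
  have hb2 : b ≤ 2 := by have := hs 1; have := hs 3; rw [hb]; linarith
  obtain ⟨hint, hle⟩ := hcomp lam hlam1 a b ha0 ha2 hb0 hb2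
  obtain ⟨hint2, -⟩ := hcomp lam hlam1 2 2 two_pos le_rfl two_pos le_rfl
  set C : ℝ := (n : ℝ) ^ 8 * Real.exp (-(2 * Real.pi * (n : ℝ) ^ 2 * (X.tauSize (xm 0) + X.tauSize (xm 1)))) with hC
  have hC0 : 0 ≤ C := by rw [hC]; positivity
  -- the moment integrand along the ray
  have hfun : (fun z => Real.exp (Real.pi * ∑ j, s j *
      (maj (X.ballCoord (X.rayCentre xm n j)) z - X.tauSize (X.rayCentre xm n j))) *
        (X.kernel D.Φ (X.rayCentre xm n) z).re) = fun z => C * X.dilInt D xm (lam * a) (lam * b) z := by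
    funext z
    rw [X.moment_integrand_rayCentre D xm h02 h13 n s z]
  -- the main term along the ray
  have hmain : (fun z => (X.kernel D.Φ (X.rayCentre xm n) z).re) = fun z => C * X.dilInt D xm (2 * lam) (2 * lam) z := by
    funext z
    rw [X.kernel_re_rayCentre_eq D xm h02 h13 n z]
  -- the kernel along the ray is real, hence integrable with its real part
  have hkfun : (fun z => X.kernel D.Φ (X.rayCentre xm n) z) =
      fun z => ((C * X.dilInt D xm (2 * lam) (2 * lam) z : ℝ) : ℂ) := by
    funext z
    obtain ⟨h2, h3⟩ := X.rayCentre_symm xm h02 h13 n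
    have hz := X.kernel_re_rayCentre_eq D xm h02 h13 n z
    rw [X.kernel_symm D.Φ _ h2 h3, Complex.ofReal_re] at hz
    rw [X.kernel_symm D.Φ _ h2 h3]
    congr 1
  rw [mul_comm lam 2] at hint2
  have hkint : IntegrableOn (fun z => X.kernel D.Φ (X.rayCentre xm n) z) ball := by
    rw [hkfun]
    exact (hint2.const_mul C).ofReal
  have hre := integral_re hkint
  simp only [RCLike.re_to_complex] at hre
  refine ⟨?_, ?_⟩
  · rw [hfun]
    exact hint.const_mul C
  · rw [hfun, integral_const_mul, ← hre, hmain, integral_const_mul]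
    have hI0 : 0 ≤ ∫ z in ball, X.dilInt D xm (2 * lam) (2 * lam) z :=
      integral_nonneg fun z => X.dilInt_nonneg D xm h02 h13 _ _ z
    have hprod : (2 / a) ^ k * (2 / b) ^ k ≤ ∏ j, (1 - s j) ^ (-k) := by
      rw [Fin.prod_univ_four]
      have h02' := two_div_rpow_le (hs 0).1 (hs 0).2 (hs 2).1 (hs 2).2 hk
      have h13' := two_div_rpow_le (hs 1).1 (hs 1).2 (hs 3).1 (hs 3).2 hk
      calc (2 / a) ^ k * (2 / b) ^ k ≤ ((1 - s 0) ^ (-k) * (1 - s 2) ^ (-k)) * ((1 - s 1) ^ (-k) * (1 - s 3) ^ (-k)) :=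
            mul_le_mul h02' h13' (Real.rpow_nonneg (div_nonneg two_pos.le hb0.le) k)
              (mul_nonneg (Real.rpow_nonneg (by linarith [(hs 0).2] : (0 : ℝ) ≤ 1 - s 0) (-k))
                (Real.rpow_nonneg (by linarith [(hs 2).2] : (0 : ℝ) ≤ 1 - s 2) (-k)))
        _ = (1 - s 0) ^ (-k) * (1 - s 1) ^ (-k) * (1 - s 2) ^ (-k) * (1 - s 3) ^ (-k) := by ring
    calc C * ∫ z in ball, X.dilInt D xm (lam * a) (lam * b) z
        ≤ C * (A * (2 / a) ^ k * (2 / b) ^ k * ∫ z in ball, X.dilInt D xm (2 * lam) (2 * lam) z) :=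
          mul_le_mul_of_nonneg_left hle hC0
      _ = A * ((2 / a) ^ k * (2 / b) ^ k) * (C * ∫ z in ball, X.dilInt D xm (2 * lam) (2 * lam) z) := by ring
      _ ≤ A * (∏ j, (1 - s j) ^ (-k)) * (C * ∫ z in ball, X.dilInt D xm (2 * lam) (2 * lam) z) := by
          gcongr

/-- The cut `hkRed_ray` of S14230 with the dilation comparison DISPLAYED: `∃ A k, 0 ≤ A ∧ 0 ≤ k ∧ ∀ n ≥ 1,
MajorantMomentBoundRed D (rayCentre xm n) A k` from `∃ A k, 0 ≤ A ∧ 0 ≤ k ∧ DilationComparison D xm A k`. -/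
theorem hkRed_ray_of_exists_dilationComparison (D : X.ThetaData) (xm : X.Tuple) (h02 : xm 2 = xm 0)
    (h13 : xm 3 = xm 1) (hcomp : ∃ A k : ℝ, 0 ≤ A ∧ 0 ≤ k ∧ X.DilationComparison D xm A k) :
    ∃ A k : ℝ, 0 ≤ A ∧ 0 ≤ k ∧ ∀ n : ℕ, 1 ≤ n → X.MajorantMomentBoundRed D (X.rayCentre xm n) A k := by
  obtain ⟨A, k, hA, hk, h⟩ := hcomp
  exact ⟨A, k, hA, hk, fun n hn => X.hkRed_ray_of_dilationComparison D xm h02 h13 hA hk h n hn⟩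

end T4Data

end Summit.Ventures.HodgeRepro.Tier4.Line3

end
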